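import Mathlib
import Summits.MatrixMultiplication.MatrixMultiplication.Theorems.HiddenToeplitzCornersHiddenCornerLemmaRCapacityBasic
import Summits.MatrixMultiplication.MatrixMultiplication.Theorems.HiddenToeplitzCornersHiddenCornerLemmaRCapacityKrylov
import Summits.MatrixMultiplication.MatrixMultiplication.Theorems.HiddenToeplitzCornersHiddenCornerLemmaRCapacityPoly
import Summits.MatrixMultiplication.MatrixMultiplication.Theorems.HiddenToeplitzCornersHiddenCornerLemmaRCapacityAct

/-!
# (PS) the step lemma — lead's file (TEMP: toolkit lemmas restated with sorry until TK-A/B/C/D land)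

Paper proof: math/STRIP_THEOREM.md §2 (PS), unified form: if `S_w = g·V_s` and `S_{w+1} = g·V_{s+1}`
then `dim Rel_{w+1}(E) ≤ dim Rel_w(E) + 1`.
-/

set_option linter.dupNamespace false

namespace Summit.MatrixMultiplication.MatrixMultiplication.Theorems

open Polynomial

variable {r : ℕ}



/-! ### finiteness -/

section Fin_
variable (e : Fin r → (Polynomial ℂ))

/-- `degreeLT n` is finite-dimensional. -/
theorem hclR_fd_degreeLT (n : ℕ) : FiniteDimensional ℂ ↥(Polynomial.degreeLT ℂ n) :=
  LinearEquiv.finiteDimensional (Polynomial.degreeLTEquiv ℂ n).symm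


/-- The Krylov space is finite-dimensional. -/
theorem hclR_fd_KryL (w : ℕ) : FiniteDimensional ℂ ↥((Submodule.span ℂ (Set.range (fun p : Fin (r) × Fin (w) => Polynomial.divX^[(Prod.snd p).val] ((e : Fin r → Polynomial ℂ) (Prod.fst p)))))) :=
  FiniteDimensional.span_of_finite ℂ (Set.finite_range _)

/-- `S_w` is finite-dimensional. -/
theorem hclR_fd_SL (w : ℕ) : FiniteDimensional ℂ ↥((⨆ b : Fin r, Submodule.map (LinearMap.proj b : (Fin r → Polynomial ℂ) →ₗ[ℂ] Polynomial ℂ) (LinearMap.ker (∑ c : Fin r, LinearMap.comp (Polynomial.lsum (fun (i : ℕ) => LinearMap.smulRight (LinearMap.id : ℂ →ₗ[ℂ] ℂ) (Polynomial.divX^[i] (e c : Polynomial ℂ))) : Polynomial ℂ →ₗ[ℂ] Polynomial ℂ) (LinearMap.proj c : (Fin r → Polynomial ℂ) →ₗ[ℂ] Polynomial ℂ)) ⊓ (Submodule.pi Set.univ (fun _ : Fin r => Polynomial.degreeLT ℂ (w)) : Submodule ℂ (Fin r → Polynomial ℂ))))) := by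
  haveI := hclR_fd_degreeLT w
  exact Submodule.finiteDimensional_of_le (hclR_SL_le_degreeLT e w)

/-- The degree-bounded tuples are finite-dimensional. -/
theorem hclR_fd_DegLT (w : ℕ) : FiniteDimensional ℂ ↥((Submodule.pi Set.univ (fun _ : Fin r => Polynomial.degreeLT ℂ (w)) : Submodule ℂ (Fin r → Polynomial ℂ))) := by
  haveI : FiniteDimensional ℂ ↥(Polynomial.degreeLT ℂ w) := hclR_fd_degreeLT w
  -- `DegLT` is the image of the product of the `degreeLT w` under the obvious linear equivalence
  let Φ : (Fin r → ↥(Polynomial.degreeLT ℂ w)) →ₗ[ℂ] (Fin r → (Polynomial ℂ)) :=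
    LinearMap.pi (fun c => (Polynomial.degreeLT ℂ w).subtype ∘ₗ LinearMap.proj c)
  have hrange : (Submodule.pi Set.univ (fun _ : Fin r => Polynomial.degreeLT ℂ (w)) : Submodule ℂ (Fin r → Polynomial ℂ)) ≤ LinearMap.range Φ := by
    intro α hα
    refine ⟨fun c => ⟨α c, ?_⟩, ?_⟩
    · exact (Submodule.mem_pi.mp hα) c (Set.mem_univ c)
    · funext c; rfl
  haveI : FiniteDimensional ℂ ↥(LinearMap.range Φ) := LinearMap.finiteDimensional_range Φ
  exact Submodule.finiteDimensional_of_le hrange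

/-- `Rel_w` is finite-dimensional. -/
theorem hclR_fd_RelL (w : ℕ) : FiniteDimensional ℂ ↥((LinearMap.ker (∑ c : Fin r, LinearMap.comp (Polynomial.lsum (fun (i : ℕ) => LinearMap.smulRight (LinearMap.id : ℂ →ₗ[ℂ] ℂ) (Polynomial.divX^[i] (e c : Polynomial ℂ))) : Polynomial ℂ →ₗ[ℂ] Polynomial ℂ) (LinearMap.proj c : (Fin r → Polynomial ℂ) →ₗ[ℂ] Polynomial ℂ)) ⊓ (Submodule.pi Set.univ (fun _ : Fin r => Polynomial.degreeLT ℂ (w)) : Submodule ℂ (Fin r → Polynomial ℂ)))) := by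
  haveI := hclR_fd_DegLT (r := r) w
  exact Submodule.finiteDimensional_of_le inf_le_right

end Fin_

/-! ### `act` helpers -/

section Act

/-- `act α 0 = 0`. -/
theorem hclR_act_zero_right (α : (Polynomial ℂ)) : ((Polynomial.lsum (fun (i : ℕ) => LinearMap.smulRight (LinearMap.id : ℂ →ₗ[ℂ] ℂ) (Polynomial.divX^[i] ((0 : (Polynomial ℂ)) : Polynomial ℂ))) : Polynomial ℂ →ₗ[ℂ] Polynomial ℂ)) α = 0 := by
  have h := hclR_act_smul_right (0 : ℂ) (0 : (Polynomial ℂ)) α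
  simpa using h

/-- `act α (Σ f_i) = Σ act α f_i`. -/
theorem hclR_act_sum_right {ι : Type*} (s : Finset ι) (f : ι → (Polynomial ℂ)) (α : (Polynomial ℂ)) :
    ((Polynomial.lsum (fun (i : ℕ) => LinearMap.smulRight (LinearMap.id : ℂ →ₗ[ℂ] ℂ) (Polynomial.divX^[i] ((∑ j ∈ s, f j) : Polynomial ℂ))) : Polynomial ℂ →ₗ[ℂ] Polynomial ℂ)) α = ∑ j ∈ s, ((Polynomial.lsum (fun (i : ℕ) => LinearMap.smulRight (LinearMap.id : ℂ →ₗ[ℂ] ℂ) (Polynomial.divX^[i] (f j : Polynomial ℂ))) : Polynomial ℂ →ₗ[ℂ] Polynomial ℂ)) α := by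
  classical
  induction s using Finset.induction_on with
  | empty => simpa using hclR_act_zero_right α
  | insert a s ha ih =>
    rw [Finset.sum_insert ha, Finset.sum_insert ha, hclR_act_add_right, ih]

/-- `act α (divX^[v] f) = divX^[v] (act α f)`. -/
theorem hclR_act_divX_iterate_comm (f α : (Polynomial ℂ)) (v : ℕ) :
    ((Polynomial.lsum (fun (i : ℕ) => LinearMap.smulRight (LinearMap.id : ℂ →ₗ[ℂ] ℂ) (Polynomial.divX^[i] (Polynomial.divX^[v] f : Polynomial ℂ))) : Polynomial ℂ →ₗ[ℂ] Polynomial ℂ)) α = Polynomial.divX^[v] (((Polynomial.lsum (fun (i : ℕ) => LinearMap.smulRight (LinearMap.id : ℂ →ₗ[ℂ] ℂ) (Polynomial.divX^[i] (f : Polynomial ℂ))) : Polynomial ℂ →ₗ[ℂ] Polynomial ℂ)) α) := by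
  induction v generalizing f with
  | zero => simp
  | succ v ih =>
    rw [Function.iterate_succ_apply, Function.iterate_succ_apply, ← hclR_act_divX_comm, ih]

/-- additivity of iterated `divX`. -/
theorem hclR_divX_iterate_add (p q : (Polynomial ℂ)) (v : ℕ) :
    Polynomial.divX^[v] (p + q) = Polynomial.divX^[v] p + Polynomial.divX^[v] q := by
  induction v generalizing p q with
  | zero => simp
  | succ v ih => rw [Function.iterate_succ_apply, Function.iterate_succ_apply,
      Function.iterate_succ_apply, Polynomial.divX_add, ih]

/-- iterated `divX` of zero. -/
theorem hclR_divX_iterate_zero (v : ℕ) : Polynomial.divX^[v] (0 : (Polynomial ℂ)) = 0 := by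
  induction v with
  | zero => simp
  | succ v ih => rw [Function.iterate_succ_apply, Polynomial.divX_zero, ih]

/-- iterated `divX` of a finite sum. -/
theorem hclR_divX_iterate_sum {ι : Type*} (s : Finset ι) (f : ι → (Polynomial ℂ)) (v : ℕ) :
    Polynomial.divX^[v] (∑ i ∈ s, f i) = ∑ i ∈ s, Polynomial.divX^[v] (f i) := by
  classical
  induction s using Finset.induction_on with
  | empty => simpa using hclR_divX_iterate_zero v
  | insert a s ha ih => rw [Finset.sum_insert ha, Finset.sum_insert ha, hclR_divX_iterate_add, ih]

/-- The evaluation map, unfolded: `(∑ c : Fin r, LinearMap.comp (Polynomial.lsum (fun (i : ℕ) => LinearMap.smulRight (LinearMap.id : ℂ →ₗ[ℂ] ℂ) (Polynomial.divX^[i] (e c : Polynomial ℂ))) : Polynomial ℂ →ₗ[ℂ] Polynomial ℂ) (LinearMap.proj c : (Fin r → Polynomial ℂ) →ₗ[ℂ] Polynomial ℂ)) α = Σ_c act (α c) (e c)`. -/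
theorem hclR_EvL_apply (e : Fin r → (Polynomial ℂ)) (α : Fin r → (Polynomial ℂ)) :
    ((∑ c : Fin r, LinearMap.comp (Polynomial.lsum (fun (i : ℕ) => LinearMap.smulRight (LinearMap.id : ℂ →ₗ[ℂ] ℂ) (Polynomial.divX^[i] (e c : Polynomial ℂ))) : Polynomial ℂ →ₗ[ℂ] Polynomial ℂ) (LinearMap.proj c : (Fin r → Polynomial ℂ) →ₗ[ℂ] Polynomial ℂ))) α = ∑ c : Fin r, ((Polynomial.lsum (fun (i : ℕ) => LinearMap.smulRight (LinearMap.id : ℂ →ₗ[ℂ] ℂ) (Polynomial.divX^[i] (e c : Polynomial ℂ))) : Polynomial ℂ →ₗ[ℂ] Polynomial ℂ)) (α c) := by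
  simp [LinearMap.sum_apply]

end Act

/-! ### transport of relations along `g = X^v g₀` -/

section Transport

variable (e : Fin r → (Polynomial ℂ)) (g : (Polynomial ℂ))

-- The shifted frame `e' c = divX^[v] (e c)` with `v = natTrailingDegree g`.
/-- `act g f = act g₀ (divX^[v] f)` where `g = X^v g₀`. -/
theorem hclR_act_g_eq (hg : g ≠ 0) (f : (Polynomial ℂ)) :
    ((Polynomial.lsum (fun (i : ℕ) => LinearMap.smulRight (LinearMap.id : ℂ →ₗ[ℂ] ℂ) (Polynomial.divX^[i] (f : Polynomial ℂ))) : Polynomial ℂ →ₗ[ℂ] Polynomial ℂ)) g = ((Polynomial.lsum (fun (i : ℕ) => LinearMap.smulRight (LinearMap.id : ℂ →ₗ[ℂ] ℂ) (Polynomial.divX^[i] (Polynomial.divX^[g.natTrailingDegree] f : Polynomial ℂ))) : Polynomial ℂ →ₗ[ℂ] Polynomial ℂ))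
      (Polynomial.divX^[g.natTrailingDegree] g) := by
  obtain ⟨hfac, -⟩ := hclR_eq_X_pow_mul_divX_iterate g hg
  conv_lhs => rw [hfac, mul_comm]
  rw [hclR_act_mul, hclR_act_X_pow]

/-- KEY IDENTITY: `EvL e (g • a) = act g₀ (EvL e' a)`. -/
theorem hclR_EvL_mul_g (hg : g ≠ 0) (a : Fin r → (Polynomial ℂ)) :
    ((∑ c : Fin r, LinearMap.comp (Polynomial.lsum (fun (i : ℕ) => LinearMap.smulRight (LinearMap.id : ℂ →ₗ[ℂ] ℂ) (Polynomial.divX^[i] (e c : Polynomial ℂ))) : Polynomial ℂ →ₗ[ℂ] Polynomial ℂ) (LinearMap.proj c : (Fin r → Polynomial ℂ) →ₗ[ℂ] Polynomial ℂ))) (((LinearMap.pi (fun c : Fin (r) => LinearMap.comp (LinearMap.mulLeft ℂ (g : Polynomial ℂ)) (LinearMap.proj c : (Fin (r) → Polynomial ℂ) →ₗ[ℂ] Polynomial ℂ)) : (Fin (r) → Polynomial ℂ) →ₗ[ℂ] (Fin (r) → Polynomial ℂ))) a) =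
      ((Polynomial.lsum (fun (i : ℕ) => LinearMap.smulRight (LinearMap.id : ℂ →ₗ[ℂ] ℂ) (Polynomial.divX^[i] (((∑ c : Fin r, LinearMap.comp (Polynomial.lsum (fun (i : ℕ) => LinearMap.smulRight (LinearMap.id : ℂ →ₗ[ℂ] ℂ) (Polynomial.divX^[i] ((fun c : Fin r => Polynomial.divX^[(g : Polynomial ℂ).natTrailingDegree] ((e : Fin r → Polynomial ℂ) c)) c : Polynomial ℂ))) : Polynomial ℂ →ₗ[ℂ] Polynomial ℂ) (LinearMap.proj c : (Fin r → Polynomial ℂ) →ₗ[ℂ] Polynomial ℂ))) a : Polynomial ℂ))) : Polynomial ℂ →ₗ[ℂ] Polynomial ℂ)) (Polynomial.divX^[g.natTrailingDegree] g) := by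
  rw [hclR_EvL_apply, hclR_EvL_apply, hclR_act_sum_right]
  refine Finset.sum_congr rfl fun c _ => ?_
  have h1 : (((LinearMap.pi (fun c : Fin (r) => LinearMap.comp (LinearMap.mulLeft ℂ (g : Polynomial ℂ)) (LinearMap.proj c : (Fin (r) → Polynomial ℂ) →ₗ[ℂ] Polynomial ℂ)) : (Fin (r) → Polynomial ℂ) →ₗ[ℂ] (Fin (r) → Polynomial ℂ))) a) c = g * a c := by
    simp [LinearMap.pi_apply]
  rw [h1, mul_comm, hclR_act_mul, hclR_act_g_eq g hg (e c), ← hclR_act_mul, ← hclR_act_mul, mul_comm]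

/-- `EvL e (g • a) = 0 ↔ EvL e' a = 0`. -/
theorem hclR_EvL_mul_g_eq_zero_iff (hg : g ≠ 0) (a : Fin r → (Polynomial ℂ)) :
    ((∑ c : Fin r, LinearMap.comp (Polynomial.lsum (fun (i : ℕ) => LinearMap.smulRight (LinearMap.id : ℂ →ₗ[ℂ] ℂ) (Polynomial.divX^[i] (e c : Polynomial ℂ))) : Polynomial ℂ →ₗ[ℂ] Polynomial ℂ) (LinearMap.proj c : (Fin r → Polynomial ℂ) →ₗ[ℂ] Polynomial ℂ))) (((LinearMap.pi (fun c : Fin (r) => LinearMap.comp (LinearMap.mulLeft ℂ (g : Polynomial ℂ)) (LinearMap.proj c : (Fin (r) → Polynomial ℂ) →ₗ[ℂ] Polynomial ℂ)) : (Fin (r) → Polynomial ℂ) →ₗ[ℂ] (Fin (r) → Polynomial ℂ))) a) = 0 ↔ ((∑ c : Fin r, LinearMap.comp (Polynomial.lsum (fun (i : ℕ) => LinearMap.smulRight (LinearMap.id : ℂ →ₗ[ℂ] ℂ) (Polynomial.divX^[i] ((fun c : Fin r => Polynomial.divX^[(g : Polynomial ℂ).natTrailingDegree] ((e : Fin r →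 Polynomial ℂ) c)) c : Polynomial ℂ))) : Polynomial ℂ →ₗ[ℂ] Polynomial ℂ) (LinearMap.proj c : (Fin r → Polynomial ℂ) →ₗ[ℂ] Polynomial ℂ))) a = 0 := by
  rw [hclR_EvL_mul_g e g hg a]
  constructor
  · intro h
    exact hclR_act_injective_of_coeff_zero_ne _ _ (hclR_eq_X_pow_mul_divX_iterate g hg).2 h
  · intro h
    rw [h]
    exact hclR_act_zero_right _

/-- `Mg` is injective for `g ≠ 0`. -/
theorem hclR_MgL_injective (hg : g ≠ 0) : Function.Injective ((LinearMap.pi (fun c : Fin (r) => LinearMap.comp (LinearMap.mulLeft ℂ (g : Polynomial ℂ)) (LinearMap.proj c : (Fin (r) → Polynomial ℂ) →ₗ[ℂ] Polynomial ℂ)) : (Fin (r) → Polynomial ℂ) →ₗ[ℂ] (Fin (r) → Polynomial ℂ))) := by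
  intro a b hab
  funext c
  have := congr_fun hab c
  simp only [LinearMap.pi_apply, LinearMap.coe_comp, Function.comp_apply, LinearMap.proj_apply,
    LinearMap.mulLeft_apply] at this
  exact mul_left_cancel₀ hg this

/-- degrees: `a ∈ degreeLT n → g * a ∈ degreeLT (n + natDegree g)`. -/
theorem hclR_mul_mem_degreeLT (n : ℕ) (a : (Polynomial ℂ)) (ha : a ∈ Polynomial.degreeLT ℂ n) :
    g * a ∈ Polynomial.degreeLT ℂ (n + g.natDegree) := by
  by_cases ha0 : a = 0
  · simp [ha0]
  by_cases hg0 : g = 0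
  · simp [hg0]
  rw [Polynomial.mem_degreeLT] at ha ⊢
  have han : a.natDegree < n := by
    rw [Polynomial.degree_eq_natDegree ha0] at ha
    exact_mod_cast ha
  rw [Polynomial.degree_eq_natDegree (mul_ne_zero hg0 ha0), Polynomial.natDegree_mul hg0 ha0]
  exact_mod_cast (by omega : g.natDegree + a.natDegree < n + g.natDegree)

/-- transport (≤): `Mg (Rel_n e') ≤ Rel_m e` whenever `n + natDegree g ≤ m`. -/
theorem hclR_transport_le (hg : g ≠ 0) (n m : ℕ) (hnm : n + g.natDegree ≤ m) :
    Submodule.map ((LinearMap.pi (fun c : Fin (r) => LinearMap.comp (LinearMap.mulLeft ℂ (g : Polynomial ℂ)) (LinearMap.proj c : (Fin (r) → Polynomial ℂ) →ₗ[ℂ] Polynomial ℂ)) : (Fin (r) → Polynomial ℂ) →ₗ[ℂ] (Fin (r) → Polynomial ℂ))) ((LinearMap.ker (∑ c : Fin r, LinearMap.comp (Polynomial.lsum (fun (i : ℕ) => LinearMap.smulRight (LinearMap.id : ℂ →ₗ[ℂ] ℂ) (Polynomial.divX^[i] ((fun c : Fin r => Polynomial.divX^[(g : Polynomial ℂ).natTrailingDegree]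 ((e : Fin r → Polynomial ℂ) c)) c : Polynomial ℂ))) : Polynomial ℂ →ₗ[ℂ] Polynomial ℂ) (LinearMap.proj c : (Fin r → Polynomial ℂ) →ₗ[ℂ] Polynomial ℂ)) ⊓ (Submodule.pi Set.univ (fun _ : Fin r => Polynomial.degreeLT ℂ (n)) : Submodule ℂ (Fin r → Polynomial ℂ)))) ≤ (LinearMap.ker (∑ c : Fin r, LinearMap.comp (Polynomial.lsum (fun (i : ℕ) => LinearMap.smulRight (LinearMap.id : ℂ →ₗ[ℂ] ℂ) (Polynomial.divX^[i] (e c : Polynomial ℂ))) : Polynomial ℂ →ₗ[ℂ] Polynomial ℂ) (LinearMap.proj c : (Fin r → Polynomial ℂ) →ₗ[ℂ] Polynomial ℂ)) ⊓ (Submodule.pi Set.univ (fun _ : Fin r => Polynomial.degreeLT ℂ (m)) : Submodule ℂ (Fin r → Polynomial ℂ))) := by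
  rintro α ⟨a, ha, rfl⟩
  obtain ⟨hker, hdeg⟩ := Submodule.mem_inf.mp ha
  refine Submodule.mem_inf.mpr ⟨?_, ?_⟩
  · rw [LinearMap.mem_ker] at hker ⊢
    exact (hclR_EvL_mul_g_eq_zero_iff e g hg a).mpr hker
  · rw [Submodule.mem_pi] at hdeg ⊢
    intro c _
    have hac := hdeg c (Set.mem_univ c)
    have h1 : (((LinearMap.pi (fun c : Fin (r) => LinearMap.comp (LinearMap.mulLeft ℂ (g : Polynomial ℂ)) (LinearMap.proj c : (Fin (r) → Polynomial ℂ) →ₗ[ℂ] Polynomial ℂ)) : (Fin (r) → Polynomial ℂ) →ₗ[ℂ] (Fin (r) → Polynomial ℂ))) a) c = g * a c := by simp [LinearMap.pi_apply]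
    rw [h1]
    exact Polynomial.degreeLT_mono hnm (hclR_mul_mem_degreeLT g n (a c) hac)

/-- transport (≥): if every component of every relation in `Rel_m e` lies in `g • degreeLT n`
then `Rel_m e ≤ Mg (Rel_n e')`. -/
theorem hclR_transport_ge (hg : g ≠ 0) (n m : ℕ)
    (hcomp : ∀ α ∈ (LinearMap.ker (∑ c : Fin r, LinearMap.comp (Polynomial.lsum (fun (i : ℕ) => LinearMap.smulRight (LinearMap.id : ℂ →ₗ[ℂ] ℂ) (Polynomial.divX^[i] (e c : Polynomial ℂ))) : Polynomial ℂ →ₗ[ℂ] Polynomial ℂ) (LinearMap.proj c : (Fin r → Polynomial ℂ) →ₗ[ℂ] Polynomial ℂ)) ⊓ (Submodule.pi Set.univ (fun _ : Fin r => Polynomial.degreeLT ℂ (m)) : Submodule ℂ (Fin r → Polynomial ℂ))), ∀ c : Fin r, α c ∈ (Submodule.map (LinearMap.mulLeft ℂ (g : Polynomial ℂ)) (Polynomial.degreeLT ℂ (n)))) :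
    (LinearMap.ker (∑ c : Fin r, LinearMap.comp (Polynomial.lsum (fun (i : ℕ) => LinearMap.smulRight (LinearMap.id : ℂ →ₗ[ℂ] ℂ) (Polynomial.divX^[i] (e c : Polynomial ℂ))) : Polynomial ℂ →ₗ[ℂ] Polynomial ℂ) (LinearMap.proj c : (Fin r → Polynomial ℂ) →ₗ[ℂ] Polynomial ℂ)) ⊓ (Submodule.pi Set.univ (fun _ : Fin r => Polynomial.degreeLT ℂ (m)) : Submodule ℂ (Fin r → Polynomial ℂ))) ≤ Submodule.map ((LinearMap.pi (fun c : Fin (r) => LinearMap.comp (LinearMap.mulLeft ℂ (g : Polynomial ℂ)) (LinearMap.proj c : (Fin (r) → Polynomial ℂ) →ₗ[ℂ] Polynomial ℂ)) : (Fin (r) → Polynomial ℂ) →ₗ[ℂ] (Fin (r) → Polynomial ℂ))) ((LinearMap.ker (∑ c : Fin r, LinearMap.comp (Polynomial.lsum (fun (i : ℕ) => LinearMap.smulRight (LinearMap.id : ℂ →ₗ[ℂ] ℂ) (Polynomial.divX^[i] ((fun c : Fin r => Polynomial.divX^[(g : Polynomial ℂ).natTrailingDegree] ((e : Fin r → Polynomial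 ℂ) c)) c : Polynomial ℂ))) : Polynomial ℂ →ₗ[ℂ] Polynomial ℂ) (LinearMap.proj c : (Fin r → Polynomial ℂ) →ₗ[ℂ] Polynomial ℂ)) ⊓ (Submodule.pi Set.univ (fun _ : Fin r => Polynomial.degreeLT ℂ (n)) : Submodule ℂ (Fin r → Polynomial ℂ)))) := by
  intro α hα
  have hc : ∀ c : Fin r, ∃ a : (Polynomial ℂ), a ∈ Polynomial.degreeLT ℂ n ∧ g * a = α c := by
    intro c
    obtain ⟨a, ha, hga⟩ := hcomp α hα c
    exact ⟨a, ha, hga⟩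
  choose a ha hga using hc
  refine ⟨a, Submodule.mem_inf.mpr ⟨?_, ?_⟩, ?_⟩
  · rw [LinearMap.mem_ker]
    have hαker : ((∑ c : Fin r, LinearMap.comp (Polynomial.lsum (fun (i : ℕ) => LinearMap.smulRight (LinearMap.id : ℂ →ₗ[ℂ] ℂ) (Polynomial.divX^[i] (e c : Polynomial ℂ))) : Polynomial ℂ →ₗ[ℂ] Polynomial ℂ) (LinearMap.proj c : (Fin r → Polynomial ℂ) →ₗ[ℂ] Polynomial ℂ))) α = 0 := by
      have := (Submodule.mem_inf.mp hα).1
      rwa [LinearMap.mem_ker] at this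
    have heq : ((LinearMap.pi (fun c : Fin (r) => LinearMap.comp (LinearMap.mulLeft ℂ (g : Polynomial ℂ)) (LinearMap.proj c : (Fin (r) → Polynomial ℂ) →ₗ[ℂ] Polynomial ℂ)) : (Fin (r) → Polynomial ℂ) →ₗ[ℂ] (Fin (r) → Polynomial ℂ))) a = α := by
      funext c; simp [LinearMap.pi_apply, hga c]
    rw [← hclR_EvL_mul_g_eq_zero_iff e g hg a, heq, hαker]
  · rw [Submodule.mem_pi]
    intro c _
    exact ha c
  · funext c; simp [LinearMap.pi_apply, hga c]

/-- transport of dimensions: under both hypotheses `finrank Rel_m e = finrank Rel_n e'`. -/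
theorem hclR_finrank_transport' (hg : g ≠ 0) (n m : ℕ) (hnm : n + g.natDegree ≤ m)
    (hcomp : ∀ α ∈ (LinearMap.ker (∑ c : Fin r, LinearMap.comp (Polynomial.lsum (fun (i : ℕ) => LinearMap.smulRight (LinearMap.id : ℂ →ₗ[ℂ] ℂ) (Polynomial.divX^[i] (e c : Polynomial ℂ))) : Polynomial ℂ →ₗ[ℂ] Polynomial ℂ) (LinearMap.proj c : (Fin r → Polynomial ℂ) →ₗ[ℂ] Polynomial ℂ)) ⊓ (Submodule.pi Set.univ (fun _ : Fin r => Polynomial.degreeLT ℂ (m)) : Submodule ℂ (Fin r → Polynomial ℂ))), ∀ c : Fin r, α c ∈ (Submodule.map (LinearMap.mulLeft ℂ (g : Polynomial ℂ)) (Polynomial.degreeLT ℂ (n)))) :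
    Module.finrank ℂ ↥((LinearMap.ker (∑ c : Fin r, LinearMap.comp (Polynomial.lsum (fun (i : ℕ) => LinearMap.smulRight (LinearMap.id : ℂ →ₗ[ℂ] ℂ) (Polynomial.divX^[i] (e c : Polynomial ℂ))) : Polynomial ℂ →ₗ[ℂ] Polynomial ℂ) (LinearMap.proj c : (Fin r → Polynomial ℂ) →ₗ[ℂ] Polynomial ℂ)) ⊓ (Submodule.pi Set.univ (fun _ : Fin r => Polynomial.degreeLT ℂ (m)) : Submodule ℂ (Fin r → Polynomial ℂ)))) = Module.finrank ℂ ↥((LinearMap.ker (∑ c : Fin r, LinearMap.comp (Polynomial.lsum (fun (i : ℕ) => LinearMap.smulRight (LinearMap.id : ℂ →ₗ[ℂ] ℂ) (Polynomial.divX^[i] ((fun c : Fin r => Polynomial.divX^[(g : Polynomial ℂ).natTrailingDegree] ((e : Fin r → Polynomial ℂ) c)) c : Polynomial ℂ))) : Polynomial ℂ →ₗ[ℂ] Polynomial ℂ) (LinearMap.proj c : (Fin r → Polynomial ℂ) →ₗ[ℂ] Polynomial ℂ)) ⊓ (Submodule.pi Set.univ (fun _ : Fin r => Polynomial.degreeLT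 ℂ (n)) : Submodule ℂ (Fin r → Polynomial ℂ)))) := by
  have heq : Submodule.map ((LinearMap.pi (fun c : Fin (r) => LinearMap.comp (LinearMap.mulLeft ℂ (g : Polynomial ℂ)) (LinearMap.proj c : (Fin (r) → Polynomial ℂ) →ₗ[ℂ] Polynomial ℂ)) : (Fin (r) → Polynomial ℂ) →ₗ[ℂ] (Fin (r) → Polynomial ℂ))) ((LinearMap.ker (∑ c : Fin r, LinearMap.comp (Polynomial.lsum (fun (i : ℕ) => LinearMap.smulRight (LinearMap.id : ℂ →ₗ[ℂ] ℂ) (Polynomial.divX^[i] ((fun c : Fin r => Polynomial.divX^[(g : Polynomial ℂ).natTrailingDegree] ((e : Fin r → Polynomial ℂ) c)) c : Polynomial ℂ))) : Polynomial ℂ →ₗ[ℂ] Polynomial ℂ) (LinearMap.proj c : (Fin r → Polynomial ℂ) →ₗ[ℂ] Polynomial ℂ)) ⊓ (Submodule.pi Set.univ (fun _ : Fin r => Polynomial.degreeLT ℂ (n)) : Submodule ℂ (Fin r → Polynomial ℂ)))) = (LinearMap.ker (∑ c : Fin r, LinearMap.comp (Polynomial.lsum (fun (i : ℕ) => LinearMap.smulRight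 (LinearMap.id : ℂ →ₗ[ℂ] ℂ) (Polynomial.divX^[i] (e c : Polynomial ℂ))) : Polynomial ℂ →ₗ[ℂ] Polynomial ℂ) (LinearMap.proj c : (Fin r → Polynomial ℂ) →ₗ[ℂ] Polynomial ℂ)) ⊓ (Submodule.pi Set.univ (fun _ : Fin r => Polynomial.degreeLT ℂ (m)) : Submodule ℂ (Fin r → Polynomial ℂ))) :=
    le_antisymm (hclR_transport_le e g hg n m hnm) (hclR_transport_ge e g hg n m hcomp)
  rw [← heq]
  exact (LinearEquiv.finrank_eq
    (Submodule.equivMapOfInjective ((LinearMap.pi (fun c : Fin (r) => LinearMap.comp (LinearMap.mulLeft ℂ (g : Polynomial ℂ)) (LinearMap.proj c : (Fin (r) → Polynomial ℂ) →ₗ[ℂ] Polynomial ℂ)) : (Fin (r) → Polynomial ℂ) →ₗ[ℂ] (Fin (r) → Polynomial ℂ))) (hclR_MgL_injective g hg) _)).symm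

end Transport

/-! ### the dimension chain -/

section Chain

variable (e : Fin r → (Polynomial ℂ)) (g : (Polynomial ℂ))

/-- `EvL e' a = divX^[v] (EvL e a)` for the shifted frame `e' = divX^[v] ∘ e`. -/
theorem hclR_EvL_shift (v : ℕ) (a : Fin r → (Polynomial ℂ)) :
    ((∑ c : Fin r, LinearMap.comp (Polynomial.lsum (fun (i : ℕ) => LinearMap.smulRight (LinearMap.id : ℂ →ₗ[ℂ] ℂ) (Polynomial.divX^[i] ((fun c : Fin r => Polynomial.divX^[v] (e c)) c : Polynomial ℂ))) : Polynomial ℂ →ₗ[ℂ] Polynomial ℂ) (LinearMap.proj c : (Fin r → Polynomial ℂ) →ₗ[ℂ] Polynomial ℂ))) a =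
      Polynomial.divX^[v] (((∑ c : Fin r, LinearMap.comp (Polynomial.lsum (fun (i : ℕ) => LinearMap.smulRight (LinearMap.id : ℂ →ₗ[ℂ] ℂ) (Polynomial.divX^[i] (e c : Polynomial ℂ))) : Polynomial ℂ →ₗ[ℂ] Polynomial ℂ) (LinearMap.proj c : (Fin r → Polynomial ℂ) →ₗ[ℂ] Polynomial ℂ))) a) := by
  rw [hclR_EvL_apply, hclR_EvL_apply, hclR_divX_iterate_sum]
  refine Finset.sum_congr rfl fun c _ => ?_
  exact hclR_act_divX_iterate_comm (e c) (a c) v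

/-- (a) relations of the shifted frame exceed those of the frame by at most `v` dimensions:
`finrank Rel_m(divX^[v] ∘ e) ≤ finrank Rel_m(e) + v`. -/
theorem hclR_chain_a' (v m : ℕ) :
    Module.finrank ℂ ↥((LinearMap.ker (∑ c : Fin r, LinearMap.comp (Polynomial.lsum (fun (i : ℕ) => LinearMap.smulRight (LinearMap.id : ℂ →ₗ[ℂ] ℂ) (Polynomial.divX^[i] ((fun c : Fin r => Polynomial.divX^[v] (e c)) c : Polynomial ℂ))) : Polynomial ℂ →ₗ[ℂ] Polynomial ℂ) (LinearMap.proj c : (Fin r → Polynomial ℂ) →ₗ[ℂ] Polynomial ℂ)) ⊓ (Submodule.pi Set.univ (fun _ : Fin r => Polynomial.degreeLT ℂ (m)) : Submodule ℂ (Fin r → Polynomial ℂ)))) ≤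
      Module.finrank ℂ ↥((LinearMap.ker (∑ c : Fin r, LinearMap.comp (Polynomial.lsum (fun (i : ℕ) => LinearMap.smulRight (LinearMap.id : ℂ →ₗ[ℂ] ℂ) (Polynomial.divX^[i] (e c : Polynomial ℂ))) : Polynomial ℂ →ₗ[ℂ] Polynomial ℂ) (LinearMap.proj c : (Fin r → Polynomial ℂ) →ₗ[ℂ] Polynomial ℂ)) ⊓ (Submodule.pi Set.univ (fun _ : Fin r => Polynomial.degreeLT ℂ (m)) : Submodule ℂ (Fin r → Polynomial ℂ)))) + v := by
  haveI := hclR_fd_RelL (fun c : Fin r => Polynomial.divX^[v] (e c)) m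
  haveI := hclR_fd_RelL e m
  haveI := hclR_fd_degreeLT v
  set V := (LinearMap.ker (∑ c : Fin r, LinearMap.comp (Polynomial.lsum (fun (i : ℕ) => LinearMap.smulRight (LinearMap.id : ℂ →ₗ[ℂ] ℂ) (Polynomial.divX^[i] ((fun c : Fin r => Polynomial.divX^[v] (e c)) c : Polynomial ℂ))) : Polynomial ℂ →ₗ[ℂ] Polynomial ℂ) (LinearMap.proj c : (Fin r → Polynomial ℂ) →ₗ[ℂ] Polynomial ℂ)) ⊓ (Submodule.pi Set.univ (fun _ : Fin r => Polynomial.degreeLT ℂ (m)) : Submodule ℂ (Fin r → Polynomial ℂ))) with hV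
  let φ : ↥V →ₗ[ℂ] (Polynomial ℂ) := ((∑ c : Fin r, LinearMap.comp (Polynomial.lsum (fun (i : ℕ) => LinearMap.smulRight (LinearMap.id : ℂ →ₗ[ℂ] ℂ) (Polynomial.divX^[i] (e c : Polynomial ℂ))) : Polynomial ℂ →ₗ[ℂ] Polynomial ℂ) (LinearMap.proj c : (Fin r → Polynomial ℂ) →ₗ[ℂ] Polynomial ℂ))).domRestrict V
  -- the range of φ sits inside `degreeLT v`
  have hrange : LinearMap.range φ ≤ Polynomial.degreeLT ℂ v := by
    rintro y ⟨a, rfl⟩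
    have ha : (a : Fin r → (Polynomial ℂ)) ∈ V := a.2
    obtain ⟨hker, -⟩ := Submodule.mem_inf.mp ha
    rw [LinearMap.mem_ker, hclR_EvL_shift] at hker
    rw [LinearMap.domRestrict_apply]
    exact (hclR_divX_iterate_eq_zero_iff _ v).mp hker
  -- the kernel of φ injects into `Rel_m(e)`
  have hker : Submodule.map V.subtype (LinearMap.ker φ) ≤ (LinearMap.ker (∑ c : Fin r, LinearMap.comp (Polynomial.lsum (fun (i : ℕ) => LinearMap.smulRight (LinearMap.id : ℂ →ₗ[ℂ] ℂ) (Polynomial.divX^[i] (e c : Polynomial ℂ))) : Polynomial ℂ →ₗ[ℂ] Polynomial ℂ) (LinearMap.proj c : (Fin r → Polynomial ℂ) →ₗ[ℂ] Polynomial ℂ)) ⊓ (Submodule.pi Set.univ (fun _ : Fin r => Polynomial.degreeLT ℂ (m)) : Submodule ℂ (Fin r → Polynomial ℂ))) := by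
    rintro x ⟨a, ha, rfl⟩
    have ha' : φ a = 0 := by simpa using ha
    rw [LinearMap.domRestrict_apply] at ha'
    have haV : (a : Fin r → (Polynomial ℂ)) ∈ V := a.2
    obtain ⟨-, hdeg⟩ := Submodule.mem_inf.mp haV
    refine Submodule.mem_inf.mpr ⟨?_, hdeg⟩
    rw [LinearMap.mem_ker]
    exact ha'
  have h1 := LinearMap.finrank_range_add_finrank_ker φ
  have h2 : Module.finrank ℂ ↥(LinearMap.range φ) ≤ v := by
    calc Module.finrank ℂ ↥(LinearMap.range φ) ≤ Module.finrank ℂ ↥(Polynomial.degreeLT ℂ v) :=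
          Submodule.finrank_mono hrange
      _ = v := (hclR_finrank_degreeLT v).2
  have h3 : Module.finrank ℂ ↥(LinearMap.ker φ) ≤ Module.finrank ℂ ↥((LinearMap.ker (∑ c : Fin r, LinearMap.comp (Polynomial.lsum (fun (i : ℕ) => LinearMap.smulRight (LinearMap.id : ℂ →ₗ[ℂ] ℂ) (Polynomial.divX^[i] (e c : Polynomial ℂ))) : Polynomial ℂ →ₗ[ℂ] Polynomial ℂ) (LinearMap.proj c : (Fin r → Polynomial ℂ) →ₗ[ℂ] Polynomial ℂ)) ⊓ (Submodule.pi Set.univ (fun _ : Fin r => Polynomial.degreeLT ℂ (m)) : Submodule ℂ (Fin r → Polynomial ℂ)))) := by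
    calc Module.finrank ℂ ↥(LinearMap.ker φ)
          = Module.finrank ℂ ↥(Submodule.map V.subtype (LinearMap.ker φ)) :=
            (LinearEquiv.finrank_eq (Submodule.equivMapOfInjective V.subtype
              (Submodule.injective_subtype V) _))
      _ ≤ Module.finrank ℂ ↥((LinearMap.ker (∑ c : Fin r, LinearMap.comp (Polynomial.lsum (fun (i : ℕ) => LinearMap.smulRight (LinearMap.id : ℂ →ₗ[ℂ] ℂ) (Polynomial.divX^[i] (e c : Polynomial ℂ))) : Polynomial ℂ →ₗ[ℂ] Polynomial ℂ) (LinearMap.proj c : (Fin r → Polynomial ℂ) →ₗ[ℂ] Polynomial ℂ)) ⊓ (Submodule.pi Set.univ (fun _ : Fin r => Polynomial.degreeLT ℂ (m)) : Submodule ℂ (Fin r → Polynomial ℂ)))) := Submodule.finrank_mono hker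
  omega

/-- Convexity of `n ↦ finrank Rel_n` (for ANY tuple): `D_{n+2} + D_n ≥ 2 D_{n+1}`. -/
theorem hclR_relrank_convex (f : Fin r → (Polynomial ℂ)) (n : ℕ) :
    2 * Module.finrank ℂ ↥((LinearMap.ker (∑ c : Fin r, LinearMap.comp (Polynomial.lsum (fun (i : ℕ) => LinearMap.smulRight (LinearMap.id : ℂ →ₗ[ℂ] ℂ) (Polynomial.divX^[i] (f c : Polynomial ℂ))) : Polynomial ℂ →ₗ[ℂ] Polynomial ℂ) (LinearMap.proj c : (Fin r → Polynomial ℂ) →ₗ[ℂ] Polynomial ℂ)) ⊓ (Submodule.pi Set.univ (fun _ : Fin r => Polynomial.degreeLT ℂ (n + 1)) : Submodule ℂ (Fin r → Polynomial ℂ)))) ≤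
      Module.finrank ℂ ↥((LinearMap.ker (∑ c : Fin r, LinearMap.comp (Polynomial.lsum (fun (i : ℕ) => LinearMap.smulRight (LinearMap.id : ℂ →ₗ[ℂ] ℂ) (Polynomial.divX^[i] (f c : Polynomial ℂ))) : Polynomial ℂ →ₗ[ℂ] Polynomial ℂ) (LinearMap.proj c : (Fin r → Polynomial ℂ) →ₗ[ℂ] Polynomial ℂ)) ⊓ (Submodule.pi Set.univ (fun _ : Fin r => Polynomial.degreeLT ℂ (n + 2)) : Submodule ℂ (Fin r → Polynomial ℂ)))) + Module.finrank ℂ ↥((LinearMap.ker (∑ c : Fin r, LinearMap.comp (Polynomial.lsum (fun (i : ℕ) => LinearMap.smulRight (LinearMap.id : ℂ →ₗ[ℂ] ℂ) (Polynomial.divX^[i] (f c : Polynomial ℂ))) : Polynomial ℂ →ₗ[ℂ] Polynomial ℂ) (LinearMap.proj c : (Fin r → Polynomial ℂ) →ₗ[ℂ] Polynomial ℂ)) ⊓ (Submodule.pi Set.univ (fun _ : Fin r => Polynomial.degreeLT ℂ (n)) : Submodule ℂ (Fin r → Polynomial ℂ)))) := by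
  have h0 := hclR_finrank_RelL_add_KryL f n
  have h1 := hclR_finrank_RelL_add_KryL f (n + 1)
  have h2 := hclR_finrank_RelL_add_KryL f (n + 2)
  have hc := hclR_KryL_concave f n
  nlinarith

/-- Monotonicity of `n ↦ finrank Rel_n`. -/
theorem hclR_relrank_mono (f : Fin r → (Polynomial ℂ)) (n : ℕ) :
    Module.finrank ℂ ↥((LinearMap.ker (∑ c : Fin r, LinearMap.comp (Polynomial.lsum (fun (i : ℕ) => LinearMap.smulRight (LinearMap.id : ℂ →ₗ[ℂ] ℂ) (Polynomial.divX^[i] (f c : Polynomial ℂ))) : Polynomial ℂ →ₗ[ℂ] Polynomial ℂ) (LinearMap.proj c : (Fin r → Polynomial ℂ) →ₗ[ℂ] Polynomial ℂ)) ⊓ (Submodule.pi Set.univ (fun _ : Fin r => Polynomial.degreeLT ℂ (n)) : Submodule ℂ (Fin r → Polynomial ℂ)))) ≤ Module.finrank ℂ ↥((LinearMap.ker (∑ c : Fin r, LinearMap.comp (Polynomial.lsum (fun (i : ℕ) => LinearMap.smulRight (LinearMap.id : ℂ →ₗ[ℂ] ℂ) (Polynomial.divX^[i] (f c : Polynomial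 ℂ))) : Polynomial ℂ →ₗ[ℂ] Polynomial ℂ) (LinearMap.proj c : (Fin r → Polynomial ℂ) →ₗ[ℂ] Polynomial ℂ)) ⊓ (Submodule.pi Set.univ (fun _ : Fin r => Polynomial.degreeLT ℂ (n + 1)) : Submodule ℂ (Fin r → Polynomial ℂ)))) := by
  haveI := hclR_fd_RelL f (n + 1)
  exact Submodule.finrank_mono (hclR_RelL_mono f n)

/-- Increments are monotone: `D_{n+1+t} + D_n ≥ D_{n+t} + D_{n+1}`. -/
theorem hclR_relrank_incr_mono (f : Fin r → (Polynomial ℂ)) (n t : ℕ) :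
    Module.finrank ℂ ↥((LinearMap.ker (∑ c : Fin r, LinearMap.comp (Polynomial.lsum (fun (i : ℕ) => LinearMap.smulRight (LinearMap.id : ℂ →ₗ[ℂ] ℂ) (Polynomial.divX^[i] (f c : Polynomial ℂ))) : Polynomial ℂ →ₗ[ℂ] Polynomial ℂ) (LinearMap.proj c : (Fin r → Polynomial ℂ) →ₗ[ℂ] Polynomial ℂ)) ⊓ (Submodule.pi Set.univ (fun _ : Fin r => Polynomial.degreeLT ℂ (n + t)) : Submodule ℂ (Fin r → Polynomial ℂ)))) + Module.finrank ℂ ↥((LinearMap.ker (∑ c : Fin r, LinearMap.comp (Polynomial.lsum (fun (i : ℕ) => LinearMap.smulRight (LinearMap.id : ℂ →ₗ[ℂ] ℂ) (Polynomial.divX^[i] (f c : Polynomial ℂ))) : Polynomial ℂ →ₗ[ℂ] Polynomial ℂ) (LinearMap.proj c : (Fin r → Polynomial ℂ) →ₗ[ℂ] Polynomial ℂ)) ⊓ (Submodule.pi Set.univ (fun _ : Fin r => Polynomial.degreeLT ℂ (n + 1)) : Submodule ℂ (Fin r → Polynomial ℂ)))) ≤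
      Module.finrank ℂ ↥((LinearMap.ker (∑ c : Fin r, LinearMap.comp (Polynomial.lsum (fun (i : ℕ) => LinearMap.smulRight (LinearMap.id : ℂ →ₗ[ℂ] ℂ) (Polynomial.divX^[i] (f c : Polynomial ℂ))) : Polynomial ℂ →ₗ[ℂ] Polynomial ℂ) (LinearMap.proj c : (Fin r → Polynomial ℂ) →ₗ[ℂ] Polynomial ℂ)) ⊓ (Submodule.pi Set.univ (fun _ : Fin r => Polynomial.degreeLT ℂ (n + 1 + t)) : Submodule ℂ (Fin r → Polynomial ℂ)))) + Module.finrank ℂ ↥((LinearMap.ker (∑ c : Fin r, LinearMap.comp (Polynomial.lsum (fun (i : ℕ) => LinearMap.smulRight (LinearMap.id : ℂ →ₗ[ℂ] ℂ) (Polynomial.divX^[i] (f c : Polynomial ℂ))) : Polynomial ℂ →ₗ[ℂ] Polynomial ℂ) (LinearMap.proj c : (Fin r → Polynomial ℂ) →ₗ[ℂ] Polynomial ℂ)) ⊓ (Submodule.pi Set.univ (fun _ : Fin r => Polynomial.degreeLT ℂ (n)) : Submodule ℂ (Fin r → Polynomial ℂ)))) := by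
  induction t with
  | zero => simp [add_comm]
  | succ t ih =>
    have hc := hclR_relrank_convex f (n + t)
    have e1 : n + t + 1 = n + 1 + t := by ring
    have e2 : n + t + 2 = n + 1 + (t + 1) := by ring
    have e3 : n + (t + 1) = n + 1 + t := by ring
    rw [e1, e2] at hc
    rw [e3]
    omega

/-- Secant inequality: `D_{n+1+t} + t D_n ≥ (1+t) D_{n+1}`. -/
theorem hclR_relrank_secant (f : Fin r → (Polynomial ℂ)) (n t : ℕ) :
    (1 + t) * Module.finrank ℂ ↥((LinearMap.ker (∑ c : Fin r, LinearMap.comp (Polynomial.lsum (fun (i : ℕ) => LinearMap.smulRight (LinearMap.id : ℂ →ₗ[ℂ] ℂ) (Polynomial.divX^[i] (f c : Polynomial ℂ))) : Polynomial ℂ →ₗ[ℂ] Polynomial ℂ) (LinearMap.proj c : (Fin r → Polynomial ℂ) →ₗ[ℂ] Polynomial ℂ)) ⊓ (Submodule.pi Set.univ (fun _ : Fin r => Polynomial.degreeLT ℂ (n + 1)) : Submodule ℂ (Fin r → Polynomial ℂ)))) ≤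
      Module.finrank ℂ ↥((LinearMap.ker (∑ c : Fin r, LinearMap.comp (Polynomial.lsum (fun (i : ℕ) => LinearMap.smulRight (LinearMap.id : ℂ →ₗ[ℂ] ℂ) (Polynomial.divX^[i] (f c : Polynomial ℂ))) : Polynomial ℂ →ₗ[ℂ] Polynomial ℂ) (LinearMap.proj c : (Fin r → Polynomial ℂ) →ₗ[ℂ] Polynomial ℂ)) ⊓ (Submodule.pi Set.univ (fun _ : Fin r => Polynomial.degreeLT ℂ (n + 1 + t)) : Submodule ℂ (Fin r → Polynomial ℂ)))) + t * Module.finrank ℂ ↥((LinearMap.ker (∑ c : Fin r, LinearMap.comp (Polynomial.lsum (fun (i : ℕ) => LinearMap.smulRight (LinearMap.id : ℂ →ₗ[ℂ] ℂ) (Polynomial.divX^[i] (f c : Polynomial ℂ))) : Polynomial ℂ →ₗ[ℂ] Polynomial ℂ) (LinearMap.proj c : (Fin r → Polynomial ℂ) →ₗ[ℂ] Polynomial ℂ)) ⊓ (Submodule.pi Set.univ (fun _ : Fin r => Polynomial.degreeLT ℂ (n)) : Submodule ℂ (Fin r → Polynomial ℂ)))) := by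
  induction t with
  | zero => simp
  | succ t ih =>
    have hm := hclR_relrank_incr_mono f n (t + 1)
    have e1 : n + 1 + (t + 1) = n + 1 + t + 1 := by ring
    rw [e1] at hm ⊢
    have e2 : n + (t + 1) = n + 1 + t := by ring
    rw [e2] at hm
    nlinarith

end Chain

set_option linter.unusedVariables false in
/-- transport of dimensions — registered form. -/
theorem hclR_finrank_transport : ∀ {r : ℕ} (e : Fin r → Polynomial ℂ) (g : (Polynomial ℂ)) (hg : g ≠ 0) (n m : ℕ) (hnm : n + g.natDegree ≤ m) (hcomp : ∀ α ∈ (LinearMap.ker (∑ c : Fin r, LinearMap.comp (Polynomial.lsum (fun (i : ℕ) => LinearMap.smulRight (LinearMap.id : ℂ →ₗ[ℂ] ℂ) (Polynomial.divX^[i] (e c : Polynomial ℂ))) : Polynomial ℂ →ₗ[ℂ] Polynomial ℂ) (LinearMap.proj c : (Fin r → Polynomial ℂ) →ₗ[ℂ] Polynomial ℂ)) ⊓ (Submodule.pi Set.univ (fun _ : Fin r => Polynomial.degreeLT ℂ (m)) : Submodule ℂ (Fin r → Polynomial ℂ))), ∀ c : Fin r, α c ∈ (Submodule.map (LinearMap.mulLeft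 ℂ (g : Polynomial ℂ)) (Polynomial.degreeLT ℂ (n)))), Module.finrank ℂ ↥((LinearMap.ker (∑ c : Fin r, LinearMap.comp (Polynomial.lsum (fun (i : ℕ) => LinearMap.smulRight (LinearMap.id : ℂ →ₗ[ℂ] ℂ) (Polynomial.divX^[i] (e c : Polynomial ℂ))) : Polynomial ℂ →ₗ[ℂ] Polynomial ℂ) (LinearMap.proj c : (Fin r → Polynomial ℂ) →ₗ[ℂ] Polynomial ℂ)) ⊓ (Submodule.pi Set.univ (fun _ : Fin r => Polynomial.degreeLT ℂ (m)) : Submodule ℂ (Fin r → Polynomial ℂ)))) = Module.finrank ℂ ↥((LinearMap.ker (∑ c : Fin r, LinearMap.comp (Polynomial.lsum (fun (i : ℕ) => LinearMap.smulRight (LinearMap.id : ℂ →ₗ[ℂ] ℂ) (Polynomial.divX^[i] ((fun c : Fin r => Polynomial.divX^[(g : Polynomial ℂ).natTrailingDegree] ((e : Fin r → Polynomial ℂ) c)) c : Polynomial ℂ))) : Polynomial ℂ →ₗ[ℂ] Polynomial ℂ) (LinearMap.proj c : (Fin r → Polynomial ℂ) →ₗ[ℂ] Polynomial ℂ)) ⊓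 (Submodule.pi Set.univ (fun _ : Fin r => Polynomial.degreeLT ℂ (n)) : Submodule ℂ (Fin r → Polynomial ℂ)))) := by
  intro r e g hg n m hnm hcomp
  exact hclR_finrank_transport' e g hg n m hnm hcomp

set_option linter.unusedVariables false in
/-- chain (a) — registered form. -/
theorem hclR_chain_a : ∀ {r : ℕ} (e : Fin r → Polynomial ℂ) (v m : ℕ), Module.finrank ℂ ↥((LinearMap.ker (∑ c : Fin r, LinearMap.comp (Polynomial.lsum (fun (i : ℕ) => LinearMap.smulRight (LinearMap.id : ℂ →ₗ[ℂ] ℂ) (Polynomial.divX^[i] ((fun c : Fin r => Polynomial.divX^[v] (e c)) c : Polynomial ℂ))) : Polynomial ℂ →ₗ[ℂ] Polynomial ℂ) (LinearMap.proj c : (Fin r → Polynomial ℂ) →ₗ[ℂ] Polynomial ℂ)) ⊓ (Submodule.pi Set.univ (fun _ : Fin r => Polynomial.degreeLT ℂ (m)) : Submodule ℂ (Fin r → Polynomial ℂ)))) ≤ Module.finrank ℂ ↥((LinearMap.ker (∑ c : Fin r, LinearMap.comp (Polynomial.lsum (fun (i : ℕ) => LinearMap.smulRight (LinearMap.id : ℂ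 →ₗ[ℂ] ℂ) (Polynomial.divX^[i] (e c : Polynomial ℂ))) : Polynomial ℂ →ₗ[ℂ] Polynomial ℂ) (LinearMap.proj c : (Fin r → Polynomial ℂ) →ₗ[ℂ] Polynomial ℂ)) ⊓ (Submodule.pi Set.univ (fun _ : Fin r => Polynomial.degreeLT ℂ (m)) : Submodule ℂ (Fin r → Polynomial ℂ)))) + v := by
  intro r e v m
  exact hclR_chain_a' e v m


end Summit.MatrixMultiplication.MatrixMultiplication.Theorems
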